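import Mathlib

/-!
# The `T = 0` Gaussian-domination door: occupation bounds from an `H⁻¹` (static susceptibility)
bound on the particle-addition vector

Conjunct `BoseEinsteinCondensation` of `AtomisticToContinuum` — soloist report `paper/sharpest.md`
§4.10 (form (ML-GD⁺) of the missing lemma).  Kernel form, in an abstract inner product space, of
the three elementary steps behind it.

Physical reading (torus, soft `v ∈ L¹`, units `ħ²/2m = 1`).  `Ψ = Ψ₀^{(N)}` the ground state of
`H_N`, `f := a_k† Ψ` (momentum `k ≠ 0`, `‖f‖² = n_k + 1`), `h := H_{N+1} − E₀(N+1) ≥ 0`,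
`χ₊(k) := ⟨f, h⁻¹ f⟩` (the `T = 0` particle-addition susceptibility at momentum `k`).  Then
`‖f‖⁴ ≤ χ₊(k)·⟨f, h f⟩` (Cauchy–Schwarz for the form of `h`), `⟨f, h f⟩ = D_k⁺ − μ₊(n_k+1) ≤ D_k⁺`,
and the Wagner sum rule with the variational principle in the removal sector gives
`D_k⁺ ≤ k² + 2ρ‖v‖₁ + μ₋ n_k` (`μ₋ = E₀(N) − E₀(N−1) ≤ ρ‖v‖₁`).  Hence the hypothesis
**(ML-GD⁺)** `χ₊(k) ≤ C/k²` on `0 < |k| ≤ K√(ρa)`, uniformly in `L`, implies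
`n_k ≤ Cμ₋/k² + √(C(k² + 2ρ‖v‖₁))/|k|` there and, summing, complete BEC in the dilute 3-D gas
(report §4.10).  The architecture — an upper bound on every `k ≠ 0` two-point function plus a sum
rule ⇒ macroscopic `k = 0` occupation — is that of the infrared-bound proofs (Fröhlich–Simon–Spencer
1976; Dyson–Lieb–Simon 1978; Kennedy–Lieb–Shastry 1988), with Gaussian domination as the
HYPOTHESIS; no reflection positivity is available for the continuum Bose gas and (ML-GD⁺) is open.
What is NOT open is Gaussian domination at spectral parameter `≤ 0`: `φ_k = ∇·j_k` with
`∫|j_k|² = 1/k²` makes `f` an exact divergence, `f = Σ_i ∇_i·V_i` with `Σ_i‖V_i‖² = ‖Ψ‖²/k²`, so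
`⟨f, (T + V + σ)⁻¹ f⟩ ≤ 1/k²` for all `V, σ ≥ 0` — the first theorem below in dual form; the physical
`χ₊` sits at the (extensive) spectral parameter `E₀(N+1)` instead.

* `SoloInformed.norm_inner_sq_le_of_divergence` — **divergence representation ⇒ dual (`H⁻¹`)
  bound**: if `⟨f, G⟩ = Σ_i ⟨W_i, A_i G⟩` for all `G` and `Σ_i ‖A_i G‖² ≤ q(G)`, then
  `|⟨f, G⟩|² ≤ (Σ_i ‖W_i‖²)·q(G)`.
* `SoloInformed.form_cauchySchwarz` — Cauchy–Schwarz for the form of a symmetric positive map.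
* `SoloInformed.norm_pow_four_le_of_weakInverse` — if `h g₀ = f` then
  `‖f‖⁴ ≤ re⟨g₀, h g₀⟩ · re⟨f, h f⟩` (`= χ · ⟨f, h f⟩`).
* `SoloInformed.norm_pow_four_le_of_dualBound` — the same from the dual form of the hypothesis.
* `SoloInformed.occupation_add_one_sq_le_of_gaussianDomination` — **the door** in the setting of
  the sector-gap door `SoloInformedSectorGapBound` (symmetric `H`, mutually adjoint `a`, `a†`, eigenvector `Ψ`, CCR on
  `Ψ`): `‖a†Ψ‖⁴ ≤ c·(re⟨a†Ψ, H a†Ψ⟩ − E₁‖a†Ψ‖²)` with `E₀ ≤ E₁` and `H ≥ E_m` on `aΨ` give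
  `(n+1)² ≤ c·(D + (E₀ − E_m)·n)`, `D = re⟨Ψ,[a,[H,a†]]Ψ⟩`.
* `SoloInformed.add_one_le_of_sq_le` — the arithmetic `(n+1)² ≤ c(K + μn) ⇒ n+1 ≤ cμ + √(cK)`;
* `SoloInformed.occupation_add_one_le_of_gaussianDomination` — the two combined.

References: J. Fröhlich, B. Simon, T. Spencer, Commun. Math. Phys. 50 (1976) 79; F. J. Dyson,
E. H. Lieb, B. Simon, J. Stat. Phys. 18 (1978) 335; T. Kennedy, E. H. Lieb, B. S. Shastry,
J. Stat. Phys. 53 (1988) 1019; H. Wagner, Z. Physik 195 (1966) 273.  Nearest prior use of the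
architecture for bosons (grand-canonical, `T > 0`, Duhamel function + Falk–Bruch):
D. P. Sankovich, J. Phys. Commun. 2 (2018) 101001, arXiv:1806.01241, whose Gaussian-domination
step (p. 6: `f(0) = 0`, `f′(0) ≤ 0` ⇒ `f(U) ≤ 0` for small `U`) is not shown uniform in the volume.
-/

noncomputable section

open Complex
open scoped InnerProductSpace ComplexConjugate BigOperators

namespace Summit.AtomisticToContinuum.BoseEinsteinCondensation.Theorems

universe v w

variable {E : Type v} [NormedAddCommGroup E] [InnerProductSpace ℂ E]

section HMinusOne

variable {F : Type w} [NormedAddCommGroup F] [InnerProductSpace ℂ F]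

/-- **Divergence representation ⇒ dual bound** (the mechanism that makes Gaussian domination at
spectral parameter `≤ 0` trivial).  If the functional `⟨f, ·⟩` factors through the "gradients"
`A_i` with coefficients `W_i`, and the gradients are dominated by the form `q`, then
`|⟨f, G⟩|² ≤ (Σ‖W_i‖²) q(G)` — i.e. `‖f‖²_{q⁻¹} ≤ Σ‖W_i‖²`.  Physical instance: `A_i = ∇_i`,
`q(G) = ⟨G,(T+V+σ)G⟩` (`V, σ ≥ 0`), `f = a_k†Ψ = Σ_i∇_i·V_i`, `Σ‖V_i‖² = 1/k²`. [folklore] -/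
theorem SoloInformed.norm_inner_sq_le_of_divergence {ι : Type*} (s : Finset ι)
    (W : ι → F) (A : ι → E →ₗ[ℂ] F) (q : E → ℝ) (f : E)
    (hrep : ∀ G : E, ⟪f, G⟫_ℂ = ∑ i ∈ s, ⟪W i, A i G⟫_ℂ)
    (hform : ∀ G : E, ∑ i ∈ s, ‖A i G‖ ^ 2 ≤ q G) (G : E) :
    ‖⟪f, G⟫_ℂ‖ ^ 2 ≤ (∑ i ∈ s, ‖W i‖ ^ 2) * q G := by
  rw [hrep G]
  have h1 : ‖∑ i ∈ s, ⟪W i, A i G⟫_ℂ‖ ≤ ∑ i ∈ s, ‖W i‖ * ‖A i G‖ :=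
    (norm_sum_le _ _).trans (Finset.sum_le_sum fun i _ => norm_inner_le_norm _ _)
  have h2 : (∑ i ∈ s, ‖W i‖ * ‖A i G‖) ^ 2 ≤ (∑ i ∈ s, ‖W i‖ ^ 2) * ∑ i ∈ s, ‖A i G‖ ^ 2 :=
    Finset.sum_mul_sq_le_sq_mul_sq s (fun i => ‖W i‖) (fun i => ‖A i G‖)
  have hW : 0 ≤ ∑ i ∈ s, ‖W i‖ ^ 2 := Finset.sum_nonneg fun i _ => sq_nonneg _
  calc ‖∑ i ∈ s, ⟪W i, A i G⟫_ℂ‖ ^ 2 ≤ (∑ i ∈ s, ‖W i‖ * ‖A i G‖) ^ 2 :=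
        pow_le_pow_left₀ (norm_nonneg _) h1 2
    _ ≤ (∑ i ∈ s, ‖W i‖ ^ 2) * ∑ i ∈ s, ‖A i G‖ ^ 2 := h2
    _ ≤ (∑ i ∈ s, ‖W i‖ ^ 2) * q G := mul_le_mul_of_nonneg_left (hform G) hW

/-- **Cauchy–Schwarz for the form of a symmetric positive linear map**:
`(re⟨x, h y⟩)² ≤ re⟨x, h x⟩ · re⟨y, h y⟩`. [folklore] -/
theorem SoloInformed.form_cauchySchwarz (h : E →ₗ[ℂ] E)
    (hsymm : ∀ x y : E, ⟪h x, y⟫_ℂ = ⟪x, h y⟫_ℂ) (hpsd : ∀ x : E, 0 ≤ (⟪x, h x⟫_ℂ).re)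
    (x y : E) :
    (⟪x, h y⟫_ℂ).re ^ 2 ≤ (⟪x, h x⟫_ℂ).re * (⟪y, h y⟫_ℂ).re := by
  have hyx : (⟪y, h x⟫_ℂ).re = (⟪x, h y⟫_ℂ).re := by
    rw [← inner_conj_symm y (h x), hsymm x y, Complex.conj_re]
  have key : ∀ t : ℝ,
      0 ≤ (⟪y, h y⟫_ℂ).re * (t * t) + 2 * (⟪x, h y⟫_ℂ).re * t + (⟪x, h x⟫_ℂ).re := by
    intro t
    have h0 := hpsd (x + (t : ℂ) • y)
    have hexp : (⟪x + (t : ℂ) • y, h (x + (t : ℂ) • y)⟫_ℂ).re =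
        (⟪x, h x⟫_ℂ).re + t * (⟪x, h y⟫_ℂ).re + t * (⟪y, h x⟫_ℂ).re
          + t * (t * (⟪y, h y⟫_ℂ).re) := by
      rw [map_add, map_smul, inner_add_left, inner_add_right, inner_add_right,
        inner_smul_right, inner_smul_left, inner_smul_left, inner_smul_right,
        Complex.conj_ofReal]
      simp only [Complex.add_re, Complex.re_ofReal_mul]
      ring
    rw [hexp, hyx] at h0
    nlinarith [h0]
  have hd := discrim_le_zero key
  unfold discrim at hd
  nlinarith [hd]

/-- **Weak inverse ⇒ `‖f‖⁴ ≤ χ·⟨f, h f⟩`.**  If `h` is symmetric and positive and `h g₀ = f`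
(so `χ := re⟨g₀, h g₀⟩ = ⟨f, h⁻¹ f⟩`), then `‖f‖⁴ ≤ χ · re⟨f, h f⟩`.  Physical instance:
`h = H_{N+1} − E₀(N+1)` on the momentum-`k` sector, `f = a_k†Ψ₀`, `‖f‖² = n_k + 1`:
`(n_k + 1)² ≤ χ₊(k)·(D_k⁺ − μ₊(n_k+1))`. [folklore] -/
theorem SoloInformed.norm_pow_four_le_of_weakInverse (h : E →ₗ[ℂ] E)
    (hsymm : ∀ x y : E, ⟪h x, y⟫_ℂ = ⟪x, h y⟫_ℂ) (hpsd : ∀ x : E, 0 ≤ (⟪x, h x⟫_ℂ).re)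
    {f g₀ : E} (hinv : h g₀ = f) :
    ‖f‖ ^ 4 ≤ (⟪g₀, h g₀⟫_ℂ).re * (⟪f, h f⟫_ℂ).re := by
  have nsq : ‖f‖ ^ 2 = (⟪f, f⟫_ℂ).re := by
    rw [← inner_self_eq_norm_sq (𝕜 := ℂ) f]; rfl
  have h1 : ‖f‖ ^ 2 = (⟪g₀, h f⟫_ℂ).re := by
    rw [nsq, ← hsymm g₀ f, hinv]
  have h2 := SoloInformed.form_cauchySchwarz h hsymm hpsd g₀ f
  calc ‖f‖ ^ 4 = (‖f‖ ^ 2) ^ 2 := by ring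
    _ = (⟪g₀, h f⟫_ℂ).re ^ 2 := by rw [h1]
    _ ≤ (⟪g₀, h g₀⟫_ℂ).re * (⟪f, h f⟫_ℂ).re := h2

/-- **Dual form ⇒ `‖f‖⁴ ≤ c·q(f)`** (take `G = f` in the dual bound). [folklore] -/
theorem SoloInformed.norm_pow_four_le_of_dualBound (q : E → ℝ) {f : E} {c : ℝ}
    (hdual : ∀ G : E, ‖⟪f, G⟫_ℂ‖ ^ 2 ≤ c * q G) : ‖f‖ ^ 4 ≤ c * q f := by
  have hf : ‖⟪f, f⟫_ℂ‖ = ‖f‖ ^ 2 := by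
    rw [inner_self_eq_norm_sq_to_K, norm_pow, RCLike.norm_ofReal, abs_norm]
  calc ‖f‖ ^ 4 = (‖f‖ ^ 2) ^ 2 := by ring
    _ = ‖⟪f, f⟫_ℂ‖ ^ 2 := by rw [hf]
    _ ≤ c * q f := hdual f

end HMinusOne

section Arithmetic

/-- **The quadratic-inequality step**: `(n+1)² ≤ c (K + μ n)` with `c, K, μ ≥ 0`
implies `n + 1 ≤ c μ + √(c K)`.  (With `c = C/k²`, `K = k² + 2ρ‖v‖₁`, `μ = μ₋`:
`n_k ≤ Cμ₋/k² + √(C(k² + 2ρ‖v‖₁))/|k|`.) -/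
theorem SoloInformed.add_one_le_of_sq_le {n c K μ : ℝ} (hc : 0 ≤ c) (hK : 0 ≤ K)
    (hμ : 0 ≤ μ) (h : (n + 1) ^ 2 ≤ c * (K + μ * n)) :
    n + 1 ≤ c * μ + Real.sqrt (c * K) := by
  set s := Real.sqrt (c * K) with hs
  have hs0 : 0 ≤ s := Real.sqrt_nonneg _
  have hs2 : s ^ 2 = c * K := Real.sq_sqrt (mul_nonneg hc hK)
  by_contra hlt
  have hlt' : c * μ + s < n + 1 := lt_of_not_ge hlt
  have h1 : s < n + 1 - c * μ := by linarith
  have h2 : s ^ 2 < (n + 1 - c * μ) ^ 2 := pow_lt_pow_left₀ h1 hs0 two_ne_zero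
  have hcμ : 0 ≤ c * μ := mul_nonneg hc hμ
  have hP : 0 ≤ c * μ * (n + 1 - c * μ) := mul_nonneg hcμ (by linarith)
  nlinarith [h, h2, hP, hcμ, hs2]

end Arithmetic

section Door

variable {H a adag : E →ₗ[ℂ] E} {Ψ : E} {E₀ : ℝ}

/-- **The Gaussian-domination door.**  Let `H` be symmetric, `a`, `a†` mutually adjoint,
`H Ψ = E₀ Ψ`, `‖Ψ‖ = 1`, `a a† Ψ = a† a Ψ + Ψ` (so `‖a†Ψ‖² = n + 1`, `n := ‖aΨ‖²`).  Suppose the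
addition vector obeys the Gaussian-domination-type bound
`‖a†Ψ‖⁴ ≤ c · (re⟨a†Ψ, H a†Ψ⟩ − E₁ ‖a†Ψ‖²)` with `E₀ ≤ E₁` (physically `E₁ = E₀(N+1)` and
`c = χ₊(k)` by `norm_pow_four_le_of_weakInverse`, or `c = C/k²` under (ML-GD⁺)), and that the form
of `H` is at least `E_m` on `aΨ` (removal sector; `E_m = E₀(N−1)`).  Then, with the Wagner double
commutator `D = re⟨Ψ,[a,[H,a†]]Ψ⟩`,  `(n + 1)² ≤ c · (D + (E₀ − E_m)·n)`. [report §4.10] -/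
theorem SoloInformed.occupation_add_one_sq_le_of_gaussianDomination {E₁ Em c : ℝ}
    (hH : ∀ x y : E, ⟪H x, y⟫_ℂ = ⟪x, H y⟫_ℂ)
    (hadj : ∀ x y : E, ⟪adag x, y⟫_ℂ = ⟪x, a y⟫_ℂ) (hΨ : H Ψ = (E₀ : ℂ) • Ψ) (hnorm : ‖Ψ‖ = 1)
    (hCCR : a (adag Ψ) = adag (a Ψ) + Ψ) (hc : 0 ≤ c) (hE₁ : E₀ ≤ E₁)
    (hGD : ‖adag Ψ‖ ^ 4 ≤ c * ((⟪adag Ψ, H (adag Ψ)⟫_ℂ).re - E₁ * ‖adag Ψ‖ ^ 2))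
    (hminus : Em * ‖a Ψ‖ ^ 2 ≤ (⟪a Ψ, H (a Ψ)⟫_ℂ).re) :
    (‖a Ψ‖ ^ 2 + 1) ^ 2 ≤
      c * ((⟪Ψ, a (H (adag Ψ)) - a (adag (H Ψ)) - H (adag (a Ψ)) + adag (H (a Ψ))⟫_ℂ).re
        + (E₀ - Em) * ‖a Ψ‖ ^ 2) := by
  have nsq : ∀ x : E, ‖x‖ ^ 2 = (⟪x, x⟫_ℂ).re := fun x => by
    rw [← inner_self_eq_norm_sq (𝕜 := ℂ) x]; rfl
  -- ⟨Ψ, a† a Ψ⟩ = ‖aΨ‖²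
  have h2 : ⟪Ψ, adag (a Ψ)⟫_ℂ = ⟪a Ψ, a Ψ⟫_ℂ := by
    rw [← inner_conj_symm, hadj (a Ψ) Ψ, inner_conj_symm]
  -- CCR on the state: ‖a†Ψ‖² = ‖aΨ‖² + 1  (as in `SoloInformedSectorGapBound`)
  have hn : ‖adag Ψ‖ ^ 2 = ‖a Ψ‖ ^ 2 + 1 := by
    have h1 : ⟪adag Ψ, adag Ψ⟫_ℂ = ⟪Ψ, a (adag Ψ)⟫_ℂ := hadj Ψ (adag Ψ)
    have h3 : ‖Ψ‖ ^ 2 = 1 := by rw [hnorm, one_pow]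
    rw [nsq, nsq, h1, hCCR, inner_add_right, h2, Complex.add_re, ← nsq Ψ, h3]
  -- the Wagner sum-rule identity (as in `SoloInformedSectorGapBound.doubleCommutator_eq`)
  have hid : (⟪Ψ, a (H (adag Ψ)) - a (adag (H Ψ)) - H (adag (a Ψ)) + adag (H (a Ψ))⟫_ℂ).re =
      (⟪adag Ψ, H (adag Ψ)⟫_ℂ).re + (⟪a Ψ, H (a Ψ)⟫_ℂ).re
        - E₀ * (‖adag Ψ‖ ^ 2 + ‖a Ψ‖ ^ 2) := by
    have t1 : ⟪Ψ, a (H (adag Ψ))⟫_ℂ = ⟪adag Ψ, H (adag Ψ)⟫_ℂ := (hadj Ψ (H (adag Ψ))).symm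
    have t2 : ⟪Ψ, a (adag (H Ψ))⟫_ℂ = (E₀ : ℂ) * ⟪adag Ψ, adag Ψ⟫_ℂ := by
      rw [← hadj Ψ (adag (H Ψ)), hΨ, map_smul, inner_smul_right]
    have t3 : ⟪Ψ, H (adag (a Ψ))⟫_ℂ = (E₀ : ℂ) * ⟪a Ψ, a Ψ⟫_ℂ := by
      rw [← hH Ψ (adag (a Ψ)), hΨ, inner_smul_left, Complex.conj_ofReal, h2]
    have t4 : ⟪Ψ, adag (H (a Ψ))⟫_ℂ = ⟪a Ψ, H (a Ψ)⟫_ℂ := by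
      rw [← inner_conj_symm, hadj (H (a Ψ)) Ψ, inner_conj_symm]
    rw [inner_add_right, inner_sub_right, inner_sub_right, t1, t2, t3, t4,
      Complex.add_re, Complex.sub_re, Complex.sub_re,
      Complex.re_ofReal_mul, Complex.re_ofReal_mul, nsq, nsq]
    ring
  have h4 : ‖adag Ψ‖ ^ 4 = (‖a Ψ‖ ^ 2 + 1) ^ 2 := by
    rw [show (4 : ℕ) = 2 * 2 from rfl, pow_mul, hn]
  rw [h4, hn] at hGD
  rw [hid, hn]
  -- re⟨a†Ψ, H a†Ψ⟩ − E₁(n+1) ≤ D + (E₀ − Em) n, then multiply by c ≥ 0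
  have hbound : (⟪adag Ψ, H (adag Ψ)⟫_ℂ).re - E₁ * (‖a Ψ‖ ^ 2 + 1) ≤
      (⟪adag Ψ, H (adag Ψ)⟫_ℂ).re + (⟪a Ψ, H (a Ψ)⟫_ℂ).re
        - E₀ * (‖a Ψ‖ ^ 2 + 1 + ‖a Ψ‖ ^ 2) + (E₀ - Em) * ‖a Ψ‖ ^ 2 := by
    nlinarith [hminus, hE₁, sq_nonneg ‖a Ψ‖]
  exact hGD.trans (mul_le_mul_of_nonneg_left hbound hc)

/-- **Occupation bound from Gaussian domination** (the door and the arithmetic combined):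
under the hypotheses of `occupation_add_one_sq_le_of_gaussianDomination`, with `D ≥ 0` and
`E_m ≤ E₀`:  `n + 1 ≤ c (E₀ − E_m) + √(c D)`.  For the Bose gas on the torus with `v ∈ L¹`,
`c = C/k²`, `D ≤ k² + 2ρ‖v‖₁`, `E₀ − E_m = μ₋ ≤ ρ‖v‖₁`: `n_k ≤ Cρ‖v‖₁/k² + √(C(k² + 2ρ‖v‖₁))/|k|`,
whose sum over `0 < |k| ≤ K√(ρa)` is `O(N√(ρa³)·poly(K))` (report §4.10). -/
theorem SoloInformed.occupation_add_one_le_of_gaussianDomination {E₁ Em c D : ℝ}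
    (hH : ∀ x y : E, ⟪H x, y⟫_ℂ = ⟪x, H y⟫_ℂ)
    (hadj : ∀ x y : E, ⟪adag x, y⟫_ℂ = ⟪x, a y⟫_ℂ) (hΨ : H Ψ = (E₀ : ℂ) • Ψ) (hnorm : ‖Ψ‖ = 1)
    (hCCR : a (adag Ψ) = adag (a Ψ) + Ψ) (hc : 0 ≤ c) (hE₁ : E₀ ≤ E₁) (hEm : Em ≤ E₀)
    (hGD : ‖adag Ψ‖ ^ 4 ≤ c * ((⟪adag Ψ, H (adag Ψ)⟫_ℂ).re - E₁ * ‖adag Ψ‖ ^ 2))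
    (hminus : Em * ‖a Ψ‖ ^ 2 ≤ (⟪a Ψ, H (a Ψ)⟫_ℂ).re)
    (hD : (⟪Ψ, a (H (adag Ψ)) - a (adag (H Ψ)) - H (adag (a Ψ)) + adag (H (a Ψ))⟫_ℂ).re ≤ D)
    (hD0 : 0 ≤ D) :
    ‖a Ψ‖ ^ 2 + 1 ≤ c * (E₀ - Em) + Real.sqrt (c * D) := by
  have h1 := SoloInformed.occupation_add_one_sq_le_of_gaussianDomination
    hH hadj hΨ hnorm hCCR hc hE₁ hGD hminus
  have hμ : 0 ≤ E₀ - Em := by linarith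
  have h2 : (‖a Ψ‖ ^ 2 + 1) ^ 2 ≤ c * (D + (E₀ - Em) * ‖a Ψ‖ ^ 2) := by
    refine h1.trans (mul_le_mul_of_nonneg_left ?_ hc)
    linarith
  exact SoloInformed.add_one_le_of_sq_le hc hD0 hμ h2

end Door

end Summit.AtomisticToContinuum.BoseEinsteinCondensation.Theorems

end
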